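import Literature.Topology.FourManifolds.ManifoldShrink
import Literature.Topology.FourManifolds.Trisections
import Literature.Topology.FourManifolds.CerfGammaFourProofs
import Literature.Topology.FourManifolds.OpenCollar
import HarnessLib

/-!
# Gay–Kirby trisections are natural under diffeomorphisms ACROSS universes

Topic `Literature/Topology/FourManifolds`; companion of `TrisectionFunctorGKNaturality.lean`
(`IsGKTrisection.image_diffeomorph`: a diffeomorphism `Φ : X ≅ X'` carries a Gay–Kirby trisection
`S` of `X : Type u` to the trisection `Φ '' S i` of `X' : Type (max u v)` — the universe of `X'`
may only be LARGER, because the abstract pieces `W ≅ Z_k`, `H ≅ H_g` of `IsGKTrisection`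
(existential witnesses in the universe of the ambient manifold) are moved by `ULift`).  Here the
restriction is removed: `IsGKTrisection.preimage_diffeomorph` — stated as a PULLBACK, sectors
`Φ ⁻¹' S i` along `Φ : X' ≅ X` — allows `X : Type u`, `X' : Type v` for ARBITRARY `u`, `v` (the
push-forward along `Ψ : X ≅ X'` is the pullback along `Ψ⁻¹`, `Ψ '' S i = Ψ⁻¹ ⁻¹' S i`,
`Diffeomorph.image_eq_preimage_symm`; for `X' : Type (max u v)` it is `image_diffeomorph`).  The
pieces are moved by `Shrink.{v}` instead (`ManifoldShrink.lean`): a diffeomorphism with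
`X' : Type v` makes `X` `v`-small (`small_of_injective`), and the pieces embed in `X`, so they are
`v`-small too; `Shrink.{v} W` carries the transported charts, the same handle decomposition
(`ManifoldShrink.hasHandleDecomposition`) and the same boundary
(`ManifoldShrink.image_sh_boundary`), and is diffeomorphic to `W` (`ManifoldShrink.diffeomorph`);
the rest of the proof is that of `IsGKTrisection.image_diffeomorph` verbatim (topological
embeddings, `C^∞` immersions off `F`, corner charts and smooth embeddings composed with the two
diffeomorphisms; unions, intersections and boundaries commute with the bijection).

Purpose (universe bookkeeping for the trisection facts of the topic and of
`Literature/Barriers/SmoothPoincare4/`): with `Shrink.{0} X` (`small_of_secondCountableTopology`)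
and this theorem, a named fact over `IsGKTrisection` stated for `X : Type u` follows from its
instance at `Type 0` — see `IsGKTrisection.shrink` below (sectors `sh ⁻¹' S i`) and
`Literature/Barriers/SmoothPoincare4/WeaklyReducibleGenusThreeStandardProofs.lean`.
Everything here is proved; no named fact is introduced.

## References

* D. Gay, R. Kirby, *Trisecting 4-manifolds*, Geom. Topol. 20 (2016) 3097–3132: Def. 1 (read up
  to diffeomorphism). [GayKirby2016]
* A. Abrams, D. Gay, R. Kirby, *Group trisections and smooth 4-manifolds*, Geom. Topol. 22 (2018),
  p. 1540 (trisected 4-manifolds up to trisected diffeomorphism). [AbramsGayKirby2018]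
-/

noncomputable section

open Set Function
open scoped Manifold ContDiff Topology

namespace Literature.Topology.FourManifolds

universe u v

section Transport

variable {X : Type u} [TopologicalSpace X] [ChartedSpace (EuclideanSpace ℝ (Fin 4)) X]
  [IsManifold (𝓡 4) ∞ X]
  {X' : Type v} [TopologicalSpace X'] [ChartedSpace (EuclideanSpace ℝ (Fin 4)) X']
  [IsManifold (𝓡 4) ∞ X']

/-- **Gay–Kirby's Definition 1 is natural under diffeomorphisms, across arbitrary universes
(pullback form).**  If `S` is a `(g; k₀, k₁, k₂)`-trisection of the smooth 4-manifold
`X : Type u` with corners along the central surface (`IsGKTrisection`) and `Φ : X' ≅ X` is a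
diffeomorphism from a smooth 4-manifold `X' : Type v` (ANY universe `v`), then the sectors
`Φ ⁻¹' S i` form a `(g; k₀, k₁, k₂)`-trisection of `X'`.  Proof, for the push-forward along
`Ψ = Φ⁻¹ : X ≅ X'` (`Ψ '' S i = Φ ⁻¹' S i`): the abstract pieces `W ≅ Z_{kᵢ}`, `H ≅ H_g` (which
embed in `X`, itself `v`-small through `Ψ`) are replaced by their `v`-small copies `Shrink.{v} W`,
`Shrink.{v} H` with the transported charts (`ManifoldShrink.lean`: same handle decompositions,
`ManifoldShrink.hasHandleDecomposition`; same boundary, `ManifoldShrink.image_sh_boundary`) and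
re-parametrised by `Ψ ∘ e ∘ sh`, `Ψ ∘ h ∘ sh`; embeddings, immersions off `F`, corner charts
`(φ, ψ, A) ↦ (sh ≫ φ, Ψ⁻¹ ≫ ψ, A)` and smooth embeddings are composed with the diffeomorphisms
`sh : Shrink W ≅ W` and `Ψ`.  This removes the restriction `X' : Type (max u v)` of the
push-forward `IsGKTrisection.image_diffeomorph` (`TrisectionFunctorGKNaturality.lean`), whose
proof is otherwise followed line by line. [cite: GayKirby2016, Def. 1] -/
theorem IsGKTrisection.preimage_diffeomorph {g : ℕ} {k : Fin 3 → ℕ} {S : Fin 3 → Set X}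
    (h : IsGKTrisection X g k S) (Φ : X' ≃ₘ⟮𝓡 4, 𝓡 4⟯ X) :
    IsGKTrisection X' g k (fun i => Φ ⁻¹' S i) := by
  -- push-forward form along an arbitrary `Ψ : X ≅ X'`, then `Ψ := Φ⁻¹` and `Φ⁻¹ '' S i = Φ ⁻¹' S i`
  suffices key : ∀ Ψ : X ≃ₘ⟮𝓡 4, 𝓡 4⟯ X', IsGKTrisection X' g k (fun i => Ψ '' S i) by
    simpa only [Diffeomorph.symm_image_eq_preimage] using key Φ.symm
  intro Φ
  obtain ⟨hcov, hsec, hpair⟩ := h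
  have hbij : Function.Bijective Φ := EquivLike.bijective Φ
  have hinj : Function.Injective Φ := hbij.1
  haveI hXs : Small.{v} X := small_of_injective hinj
  have hI : (⋂ l, Φ '' S l) = Φ '' ⋂ l, S l := (image_iInter hbij S).symm
  refine ⟨?_, fun i => ?_, fun i j hij => ?_⟩
  · show (⋃ i, Φ '' S i) = univ
    rw [← image_iUnion, hcov, image_univ, (EquivLike.surjective Φ).range_eq]
  · obtain ⟨W, _, _, e, hM, hW, hc, hh, he, hrange, himm, hcorner, hbdry⟩ := hsec i
    haveI := hM; haveI := hW; haveI := hc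
    haveI hWs : Small.{v} W := small_of_injective he.injective
    let d : Shrink.{v} W ≃ₘ⟮𝓡∂ 4, 𝓡∂ 4⟯ W := ManifoldShrink.diffeomorph (𝓡∂ 4) W ∞
    have hdcoe : (⇑d : Shrink.{v} W → W) = ManifoldShrink.sh W := rfl
    have hdsurj : Function.Surjective d := EquivLike.surjective d
    refine ⟨Shrink.{v} W, inferInstance, inferInstance, Φ ∘ e ∘ ⇑d, inferInstance, inferInstance,
      inferInstance, ManifoldShrink.hasHandleDecomposition hh,
      Φ.toHomeomorph.isEmbedding.comp (he.comp d.toHomeomorph.isEmbedding), ?_, ?_, ?_, ?_⟩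
    · show range (Φ ∘ e ∘ ⇑d) = Φ '' S i
      rw [range_comp, range_comp, hdsurj.range_eq, image_univ, hrange]
    · intro w hw
      have hw' : e (d w) ∉ ⋂ l, S l := by
        simpa only [hI, Function.comp_apply, hinj.mem_set_image] using hw
      obtain ⟨F, _, _, hF⟩ := himm (d w) hw'
      exact ⟨F, inferInstance, inferInstance, (hF.comp_diffeomorph d).diffeomorph_comp Φ⟩
    · intro w hw
      have hw' : e (d w) ∈ ⋂ l, S l := by
        simpa only [hI, Function.comp_apply, hinj.mem_set_image] using hw
      obtain ⟨φ, ψ, A, hφ, hψ, hws, hsrc, hw0, hloc⟩ := hcorner (d w) hw'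
      have htarget : ((d.toHomeomorph.toOpenPartialHomeomorph ≫ₕ φ).extend (𝓡∂ 4)).target =
          (φ.extend (𝓡∂ 4)).target := by
        simp [OpenPartialHomeomorph.extend]
      have hsymm : ∀ y, ((d.toHomeomorph.toOpenPartialHomeomorph ≫ₕ φ).extend (𝓡∂ 4)).symm y =
          d.symm ((φ.extend (𝓡∂ 4)).symm y) := by
        intro y
        simp [OpenPartialHomeomorph.extend]
      refine ⟨d.toHomeomorph.toOpenPartialHomeomorph ≫ₕ φ,
        Φ.symm.toHomeomorph.toOpenPartialHomeomorph ≫ₕ ψ, A,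
        trans_mem_maximalAtlas_of_diffeomorph d hφ,
        trans_mem_maximalAtlas_of_diffeomorph Φ.symm hψ, ?_, ?_, ?_, ?_⟩
      · simpa using hws
      · intro w₁ hw₁
        have hw₁' : d w₁ ∈ φ.source := by simpa using hw₁
        have h₁ := hsrc hw₁'
        simp only [mem_preimage] at h₁
        simpa using h₁
      · simpa using hw0
      · intro x hx
        rw [htarget] at hx
        have hrw : A.symm ((Φ.symm.toHomeomorph.toOpenPartialHomeomorph ≫ₕ ψ)
            ((Φ ∘ e ∘ ⇑d) (((d.toHomeomorph.toOpenPartialHomeomorph ≫ₕ φ).extend (𝓡∂ 4)).symm x)))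
            = A.symm (ψ (e ((φ.extend (𝓡∂ 4)).symm x))) := by
          rw [hsymm]
          simp
        rw [hrw]
        exact hloc x hx
    · intro j hj
      show Φ '' S i ∩ Φ '' S j ⊆ (Φ ∘ e ∘ ⇑d) '' (𝓡∂ 4).boundary (Shrink.{v} W)
      rw [← image_inter hinj, image_comp Φ (e ∘ ⇑d), image_comp e ⇑d, hdcoe,
        ManifoldShrink.image_sh_boundary]
      exact image_mono (hbdry j hj)
  · obtain ⟨H, _, _, f, hM, hH, hc, hh, hf, hrange, hbdry⟩ := hpair i j hij
    haveI := hM; haveI := hH; haveI := hc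
    haveI hHs : Small.{v} H := small_of_injective hf.isEmbedding.injective
    let d : Shrink.{v} H ≃ₘ⟮𝓡∂ 3, 𝓡∂ 3⟯ H := ManifoldShrink.diffeomorph (𝓡∂ 3) H ∞
    have hdcoe : (⇑d : Shrink.{v} H → H) = ManifoldShrink.sh H := rfl
    have hdsurj : Function.Surjective d := EquivLike.surjective d
    refine ⟨Shrink.{v} H, inferInstance, inferInstance, Φ ∘ f ∘ ⇑d, inferInstance, inferInstance,
      inferInstance, ManifoldShrink.hasHandleDecomposition hh,
      (hf.comp_diffeomorph d).diffeomorph_comp Φ, ?_, ?_⟩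
    · show range (Φ ∘ f ∘ ⇑d) = Φ '' S i ∩ Φ '' S j
      rw [range_comp, range_comp, hdsurj.range_eq, image_univ, hrange, image_inter hinj]
    · show (Φ ∘ f ∘ ⇑d) '' (𝓡∂ 3).boundary (Shrink.{v} H) = ⋂ l, Φ '' S l
      rw [image_comp Φ (f ∘ ⇑d), image_comp f ⇑d, hdcoe, ManifoldShrink.image_sh_boundary, hbdry,
        hI]

/-- **Balanced form.** The pullback of a balanced `(g, k)`-trisection along a diffeomorphism
`Φ : X' ≅ X` (any universes) is a balanced `(g, k)`-trisection. [cite: GayKirby2016, Def. 1] -/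
theorem IsBalancedGKTrisection.preimage_diffeomorph {g k : ℕ} {S : Fin 3 → Set X}
    (h : IsBalancedGKTrisection X g k S) (Φ : X' ≃ₘ⟮𝓡 4, 𝓡 4⟯ X) :
    IsBalancedGKTrisection X' g k (fun i => Φ ⁻¹' S i) :=
  IsGKTrisection.preimage_diffeomorph h Φ

end Transport

/-! ### The small copy `Shrink.{v} X` of a trisected manifold is trisected -/

section ShrinkCopy

variable {X : Type u} [TopologicalSpace X] [ChartedSpace (EuclideanSpace ℝ (Fin 4)) X]
  [IsManifold (𝓡 4) ∞ X] [Small.{v} X]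

/-- **A Gay–Kirby trisection of `X` gives one of its small copy `Shrink.{v} X`** (sectors
`sh ⁻¹' S i`, `sh : Shrink X ≅ X` the canonical diffeomorphism of `ManifoldShrink.lean`).  With
`v = 0` and `Small.{0} X` from second countability (`small_of_secondCountableTopology`) this is the
step "WLOG `X : Type`" in deducing a universe-polymorphic trisection fact from its `Type 0`
instance. [cite: GayKirby2016, Def. 1] -/
theorem IsGKTrisection.shrink {g : ℕ} {k : Fin 3 → ℕ} {S : Fin 3 → Set X}
    (h : IsGKTrisection X g k S) :
    IsGKTrisection (Shrink.{v} X) g k (fun i => ManifoldShrink.diffeomorph (𝓡 4) X ∞ ⁻¹' S i) :=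
  h.preimage_diffeomorph (ManifoldShrink.diffeomorph (𝓡 4) X ∞)

/-- Balanced form of `IsGKTrisection.shrink`. [cite: GayKirby2016, Def. 1] -/
theorem IsBalancedGKTrisection.shrink {g k : ℕ} {S : Fin 3 → Set X}
    (h : IsBalancedGKTrisection X g k S) :
    IsBalancedGKTrisection (Shrink.{v} X) g k
      (fun i => ManifoldShrink.diffeomorph (𝓡 4) X ∞ ⁻¹' S i) :=
  IsGKTrisection.shrink h

end ShrinkCopy

end Literature.Topology.FourManifolds

end
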